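import Mathlib.NumberTheory.Chebyshev
import Mathlib.NumberTheory.Bertrand
import Mathlib.NumberTheory.Primorial
import Mathlib.RingTheory.Polynomial.Eisenstein.Basic
import Mathlib.Data.Nat.ChineseRemainder
import Mathlib.FieldTheory.Finite.Basic
import Mathlib.Analysis.Complex.ExponentialBounds
import Literature.Barriers.Parity.LeastPrimeValue
import Literature.NumberTheory.Sieve.BatemanHornProofs
import HarnessLib

/-!
# Polynomials with no small prime values: a proof of `McCurley1986_noSmallPrimeValues`

Companion ("Proofs") file of `Literature/Barriers/Parity/LeastPrimeValue.lean`. It DISCHARGES the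
named fact `Literature.Barriers.Parity.McCurley1986_noSmallPrimeValues` (K. S. McCurley,
*Polynomials with no small prime values*, Proc. AMS 97 (1986) 393–395, in the form reported by
Ribenboim, *The Book of Prime Number Records* (1989), Ch. 6 §III.B p. 330): there is an absolute
`c > 0` such that for every `d ≥ 1` some irreducible `f ∈ ℤ[X]` of degree `d` without fixed prime
divisor has `|f(m)|` composite for all integers `|m| < exp(c √(L(f)/log L(f)))`, `L(f)` the total
binary length of the coefficients.

## The proof given here

The primary source is not held (acq: Proc. AMS 97; only the statement as reported by Ribenboim and
by Zbl 0543.10033 / Zbl 0594.10035 is available), so the fact is proved by a direct elementary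
construction, which is NOT claimed to be McCurley's (his "proof yields explicit polynomials",
Ribenboim p. 330; so does this one). For a degree `d ≥ D₀`:

* let `y = ⌊d/2⌋ + 1`, `P = ∏_{p ≤ y} p` (primorial) and `r = ⌊P/2⌋`; for each prime `p ≤ y` the
  monic polynomial `h_p = (X − r + 1)^{d − 2(p−1)} ((X − r)^{p−1} − 1)²` of degree `d` satisfies
  `p² ∣ h_p(m)` whenever `m ≢ r (mod p)` (Fermat) and `h_p(r) = 1` (`sq_dvd_eval_localPoly`, `eval_localPoly_self`);
* by the Chinese remainder theorem on coefficients there is a MONIC `f` of degree `d` with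
  coefficients in `[0, Q)`, `Q = q² ∏_{p ≤ d} p²`, such that `f ≡ h_p (mod p²)` for `p ≤ y`,
  `f ≡ X^d (mod p²)` for `y < p ≤ d`, and `f ≡ X^d + q (mod q²)` for a Bertrand prime
  `d < q ≤ 2d` (`exists_monic_crt`);
* `f` is Eisenstein at `q`, hence irreducible, and `f(m) ≠ 0` for all `m` (`d ≥ 2`);
* no prime is a fixed divisor: `f(r) ≡ 1 (mod p)` for `p ≤ y`, `f(1) ≡ 1 (mod p)` for
  `y < p ≤ d` and for `p = q`, and a monic polynomial of degree `d < p` has at most `d` roots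
  modulo `p` (Lagrange, `polyRootCountMod_single_le_natDegree` of the tree);
* every `m` with `2|m| + 1 < P` is `≢ r (mod p)` for some prime `p ≤ y` (else `P ∣ m − r`), so
  `p² ∣ f(m) ≠ 0` and `|f(m)|` is composite;
* sizes: `Q ≤ (4^d)² (2d)² ≤ 2^{6d+2}` (`primorial_le_four_pow`), so `L(f) ≤ d(6d+2) + 1 ≤ 9d²`
  and `√(L/log L) ≤ √(2L) ≤ 5d`, i.e. `exp((1/25)√(L/log L)) ≤ exp(d/5)`; and Chebyshev's bound
  `θ(y) ≥ y log 2 − log(y+1) − 2√y log y` (Mathlib `Chebyshev.theta_ge`) gives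
  `2 exp(d/5) + 1 ≤ P` for all `d ≥ D₀` (`eventually_primorial_ge`).

For the finitely many `d < D₀` the polynomial `X^d + 26` (Eisenstein at `2`, `L = d + 5`, values
`25, 26, 27` at `m = ∓1, 0, ±1`) works once `c ≤ log 2/(2(D₀ + 4))`, because then
`exp(c√(L/log L)) ≤ 2`. The absolute constant is `c = min(1/25, log 2/(2(D₀+4)))`.

(The construction gives the range `exp(c' √L)`; only the printed `exp(c √(L/log L))` is asserted.)

## References

* P. Ribenboim, *The Book of Prime Number Records* (1989), Ch. 6 §III.B p. 330 (PDF p. 241)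
  [cite: Ribenboim1989, Ch. 6 §III.B p. 330] — the statement discharged (verified on the page).
* K. S. McCurley, Proc. AMS 97 (1986) 393–395 [cite: McCurley1986NoSmallPrimeValues, Theorem (as reported)]
  — primary source, not held.
-/

noncomputable section

open Filter Finset Polynomial Asymptotics Topology

namespace Literature.Barriers.Parity

namespace NoSmallPrimeValues

open Literature.NumberTheory.Sieve

/-! ### Compositeness from a square prime factor -/

/-- If `p² ∣ v ≠ 0` for a prime `p` then `|v|` is composite. [folklore] -/
theorem isComposite_natAbs_of_sq_dvd {p : ℕ} (hp : p.Prime) {v : ℤ} (hv : v ≠ 0)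
    (hdvd : (p : ℤ) ^ 2 ∣ v) : IsComposite v.natAbs := by
  have h1 : p ^ 2 ∣ v.natAbs := by
    have := Int.natAbs_dvd_natAbs.mpr hdvd
    simpa [Int.natAbs_pow] using this
  have hpos : 0 < v.natAbs := Int.natAbs_pos.mpr hv
  have hle : p ^ 2 ≤ v.natAbs := Nat.le_of_dvd hpos h1
  have hp2 : 2 ≤ p := hp.two_le
  refine ⟨?_, ?_⟩
  · calc 1 < 2 ^ 2 := by norm_num
      _ ≤ p ^ 2 := Nat.pow_le_pow_left hp2 2
      _ ≤ v.natAbs := hle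
  · intro hprime
    have hpd : p ∣ v.natAbs := (dvd_pow_self p two_ne_zero).trans h1
    rcases (Nat.dvd_prime hprime).mp hpd with h | h
    · exact hp.one_lt.ne' h
    · rw [← h] at hle
      nlinarith

/-! ### The local polynomials -/

/-
The local factor at the prime `p` with escape class `r` and padding exponent `e` is
`h_p = (X − (r − 1))^e · ((X − r)^{p−1} − 1)²`; it is written out in full below (no auxiliary
definition, so that this file stays a pure-proof companion).
-/

/-- The inner factor `(X − r)^{p−1} − 1` is monic of degree `p − 1` for `p ≥ 2`. [folklore] -/
theorem monic_inner {p : ℕ} (hp : 2 ≤ p) (r : ℤ) :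
    ((X - C r) ^ (p - 1) - 1 : ℤ[X]).Monic ∧ ((X - C r) ^ (p - 1) - 1 : ℤ[X]).natDegree = p - 1 := by
  have hmon : ((X - C r) ^ (p - 1) : ℤ[X]).Monic := (monic_X_sub_C r).pow _
  have hdeg : ((X - C r) ^ (p - 1) : ℤ[X]).natDegree = p - 1 := by
    rw [(monic_X_sub_C r).natDegree_pow, natDegree_X_sub_C, mul_one]
  have hlt : (1 : ℤ[X]).natDegree < ((X - C r) ^ (p - 1) : ℤ[X]).natDegree := by
    rw [hdeg, natDegree_one]; omega
  refine ⟨hmon.sub_of_left (degree_lt_degree hlt), ?_⟩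
  rw [natDegree_sub_eq_left_of_natDegree_lt hlt, hdeg]

/-- The local factor `h_p` is monic of degree `e + 2(p − 1)` (`p ≥ 2`). [folklore] -/
theorem monic_localPoly {p : ℕ} (hp : 2 ≤ p) (r : ℤ) (e : ℕ) :
    ((X - C (r - 1)) ^ e * ((X - C r) ^ (p - 1) - 1) ^ 2 : ℤ[X]).Monic ∧
      ((X - C (r - 1)) ^ e * ((X - C r) ^ (p - 1) - 1) ^ 2 : ℤ[X]).natDegree = e + 2 * (p - 1) := by
  obtain ⟨hmon, hdeg⟩ := monic_inner hp r
  have h1 : ((X - C (r - 1)) ^ e : ℤ[X]).Monic := (monic_X_sub_C _).pow e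
  have h1d : ((X - C (r - 1)) ^ e : ℤ[X]).natDegree = e := by
    rw [(monic_X_sub_C _).natDegree_pow, natDegree_X_sub_C, mul_one]
  have h2 : (((X - C r) ^ (p - 1) - 1) ^ 2 : ℤ[X]).Monic := hmon.pow 2
  have h2d : (((X - C r) ^ (p - 1) - 1) ^ 2 : ℤ[X]).natDegree = 2 * (p - 1) := by
    rw [hmon.natDegree_pow, hdeg, mul_comm]
  refine ⟨h1.mul h2, ?_⟩
  rw [h1.natDegree_mul h2, h1d, h2d]

/-- Evaluation of the local factor. [folklore] -/
theorem eval_localPoly (p : ℕ) (r : ℤ) (e : ℕ) (m : ℤ) :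
    ((X - C (r - 1)) ^ e * ((X - C r) ^ (p - 1) - 1) ^ 2 : ℤ[X]).eval m =
      (m - (r - 1)) ^ e * ((m - r) ^ (p - 1) - 1) ^ 2 := by
  simp [eval_mul, eval_pow, eval_sub, eval_X, eval_one]

/-- At the escape class the local factor takes the value `1`. [folklore] -/
theorem eval_localPoly_self {p : ℕ} (hp : 2 ≤ p) (r : ℤ) (e : ℕ) :
    ((X - C (r - 1)) ^ e * ((X - C r) ^ (p - 1) - 1) ^ 2 : ℤ[X]).eval r = 1 := by
  rw [eval_localPoly]
  have h0 : p - 1 ≠ 0 := by omega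
  simp [zero_pow h0]

/-- Off the escape class, `p²` divides the value of the local factor (Fermat's little theorem).
[folklore] -/
theorem sq_dvd_eval_localPoly {p : ℕ} (hp : p.Prime) (r : ℤ) (e : ℕ) {m : ℤ}
    (hm : ¬ (p : ℤ) ∣ m - r) :
    (p : ℤ) ^ 2 ∣ ((X - C (r - 1)) ^ e * ((X - C r) ^ (p - 1) - 1) ^ 2 : ℤ[X]).eval m := by
  rw [eval_localPoly]
  have hcop : IsCoprime (m - r) (p : ℤ) :=
    ((Nat.prime_iff_prime_int.mp hp).coprime_iff_not_dvd.mpr hm).symm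
  have h1 : (p : ℤ) ∣ (m - r) ^ (p - 1) - 1 := Int.prime_dvd_pow_sub_one hp hcop
  exact (pow_dvd_pow_of_dvd h1 2).mul_left _

/-! ### Divisibility of values from divisibility of polynomials -/

/-- If `C c ∣ g` in `ℤ[X]` then `c ∣ g(m)` for every integer `m`. [folklore] -/
theorem dvd_eval_of_C_dvd {c : ℤ} {g : ℤ[X]} (h : C c ∣ g) (m : ℤ) : c ∣ g.eval m := by
  obtain ⟨g', rfl⟩ := h
  exact ⟨g'.eval m, by rw [eval_mul, eval_C]⟩

/-- If `C c ∣ f − g` then `c ∣ f(m) − g(m)`. [folklore] -/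
theorem dvd_eval_sub_of_C_dvd {c : ℤ} {f g : ℤ[X]} (h : C c ∣ f - g) (m : ℤ) :
    c ∣ f.eval m - g.eval m := by
  have := dvd_eval_of_C_dvd h m
  rwa [eval_sub] at this

/-! ### Chinese remainder theorem for monic polynomials -/

/-- **Coefficientwise CRT.** Given finitely many pairwise coprime moduli `μ p ≥ 1` and monic
integer polynomials `t p` of one common degree `d`, there is a monic `f` of degree `d` whose lower
coefficients lie in `[0, ∏ μ p)` and with `f ≡ t p (mod μ p)` coefficientwise for every `p`.
[folklore] -/
theorem exists_monic_crt (U : Finset ℕ) (μ : ℕ → ℕ) (t : ℕ → ℤ[X]) (d : ℕ)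
    (hμ : ∀ p ∈ U, μ p ≠ 0) (hcop : (U : Set ℕ).Pairwise (Function.onFun Nat.Coprime μ))
    (ht : ∀ p ∈ U, (t p).Monic ∧ (t p).natDegree = d) :
    ∃ f : ℤ[X], f.Monic ∧ f.natDegree = d ∧ (∀ k, 0 ≤ f.coeff k) ∧
      (∀ k, k < d → f.coeff k < ∏ p ∈ U, (μ p : ℤ)) ∧ ∀ p ∈ U, C (μ p : ℤ) ∣ f - t p := by
  classical
  -- the coefficients, one CRT problem per index
  let a : ℕ → ℕ := fun k =>
    (Nat.chineseRemainderOfFinset (fun p => ((t p).coeff k % (μ p : ℤ)).toNat) μ U hμ hcop : ℕ)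
  have ha_lt : ∀ k, a k < ∏ p ∈ U, μ p := fun k =>
    Nat.chineseRemainderOfFinset_lt_prod _ μ hμ hcop
  have ha_mod : ∀ k, ∀ p ∈ U, (μ p : ℤ) ∣ (a k : ℤ) - (t p).coeff k := by
    intro k p hp
    have hk := (Nat.chineseRemainderOfFinset (fun p => ((t p).coeff k % (μ p : ℤ)).toNat)
      μ U hμ hcop).2 p hp
    -- `a k ≡ ((t p).coeff k % μ p).toNat [MOD μ p]`
    have h1 : (μ p : ℤ) ∣ ((((t p).coeff k % (μ p : ℤ)).toNat : ℕ) : ℤ) - (a k : ℤ) :=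
      (Nat.modEq_iff_dvd.mp hk)
    have hμ0 : (0 : ℤ) < μ p := by exact_mod_cast Nat.pos_of_ne_zero (hμ p hp)
    have h2 : ((((t p).coeff k % (μ p : ℤ)).toNat : ℕ) : ℤ) = (t p).coeff k % (μ p : ℤ) :=
      Int.toNat_of_nonneg (Int.emod_nonneg _ hμ0.ne')
    rw [h2] at h1
    have h3 : (μ p : ℤ) ∣ (t p).coeff k - (t p).coeff k % (μ p : ℤ) := Int.dvd_self_sub_emod
    have h4 : (μ p : ℤ) ∣ (t p).coeff k - (a k : ℤ) := by
      have := dvd_add h3 h1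
      rwa [sub_add_sub_cancel] at this
    rwa [← dvd_neg, neg_sub] at h4
  -- the polynomial
  let f : ℤ[X] := X ^ d + ∑ k ∈ range d, C (a k : ℤ) * X ^ k
  have hdeg_sum : (∑ k ∈ range d, C (a k : ℤ) * X ^ k).degree < (d : WithBot ℕ) := by
    refine (degree_sum_le (range d) (fun k => C (a k : ℤ) * X ^ k)).trans_lt ?_
    refine (Finset.sup_lt_iff (WithBot.bot_lt_coe d)).mpr fun k hk => ?_
    rw [mem_range] at hk
    exact lt_of_le_of_lt (degree_C_mul_X_pow_le k _) (WithBot.coe_lt_coe.mpr hk)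
  have hfm : f.Monic := monic_X_pow_add hdeg_sum
  have hfd : f.natDegree = d := by
    show (X ^ d + ∑ k ∈ range d, C (a k : ℤ) * X ^ k).natDegree = d
    rw [natDegree_add_eq_left_of_degree_lt, natDegree_X_pow]
    rwa [degree_X_pow]
  have hcoeff : ∀ n, f.coeff n = (if n = d then 1 else 0) + (if n < d then (a n : ℤ) else 0) := by
    intro n
    show (X ^ d + ∑ k ∈ range d, C (a k : ℤ) * X ^ k).coeff n = _
    rw [coeff_add, coeff_X_pow, finsetSum_coeff]
    simp only [coeff_C_mul_X_pow]
    rw [Finset.sum_ite_eq (range d) n (fun k => (a k : ℤ))]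
    simp [mem_range]
  refine ⟨f, hfm, hfd, ?_, ?_, ?_⟩
  · intro k
    rw [hcoeff]
    split_ifs <;> positivity
  · intro k hk
    rw [hcoeff, if_neg hk.ne, if_pos hk, zero_add]
    exact_mod_cast ha_lt k
  · intro p hp
    rw [C_dvd_iff_dvd_coeff]
    intro i
    rw [coeff_sub, hcoeff]
    obtain ⟨htm, htd⟩ := ht p hp
    rcases lt_trichotomy i d with hi | hi | hi
    · rw [if_neg hi.ne, if_pos hi, zero_add]
      exact ha_mod i p hp
    · have hc : (t p).coeff d = 1 := by rw [← htd]; exact htm.coeff_natDegree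
      rw [hi, if_pos rfl, if_neg (lt_irrefl d), hc]
      simp
    · have hc : (t p).coeff i = 0 := coeff_eq_zero_of_natDegree_lt (by omega)
      rw [if_neg hi.ne', if_neg (by omega), hc]
      simp

/-! ### Eisenstein at `q` from a congruence modulo `q²` -/

/-- A monic `f` of degree `d ≥ 1` with `f ≡ X^d + q (mod q²)` coefficientwise is Eisenstein at the
prime `q`, hence irreducible in `ℤ[X]`. [folklore] -/
theorem irreducible_of_C_sq_dvd {f : ℤ[X]} {d : ℕ} (hd : 0 < d) (hf : f.Monic)
    (hfd : f.natDegree = d) {q : ℕ} (hq : q.Prime)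
    (hdvd : C ((q : ℤ) ^ 2) ∣ f - (X ^ d + C (q : ℤ))) : Irreducible f := by
  have hqZ : Prime (q : ℤ) := Nat.prime_iff_prime_int.mp hq
  set P : Ideal ℤ := Ideal.span {(q : ℤ)} with hP
  have hPprime : P.IsPrime := (Ideal.span_singleton_prime hqZ.ne_zero).mpr hqZ
  have hco := (C_dvd_iff_dvd_coeff _ _).mp hdvd
  have hcoeff : ∀ i, (X ^ d + C (q : ℤ) : ℤ[X]).coeff i =
      (if i = d then 1 else 0) + (if i = 0 then (q : ℤ) else 0) := by
    intro i
    rw [coeff_add, coeff_X_pow, coeff_C]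
  have hE : f.IsEisensteinAt P := by
    refine hf.isEisensteinAt_of_mem_of_notMem hPprime.ne_top ?_ ?_
    · intro n hn
      rw [hfd] at hn
      rw [hP, Ideal.mem_span_singleton]
      have h1 := hco n
      rw [coeff_sub, hcoeff, if_neg hn.ne] at h1
      have h2 : (q : ℤ) ∣ f.coeff n - (0 + if n = 0 then (q : ℤ) else 0) :=
        (dvd_pow_self (q : ℤ) two_ne_zero).trans h1
      have h3 : (q : ℤ) ∣ (0 + if n = 0 then (q : ℤ) else 0) := by
        split_ifs <;> simp
      simpa using dvd_add h2 h3
    · rw [hP, Ideal.span_singleton_pow, Ideal.mem_span_singleton]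
      intro h
      have h1 := hco 0
      rw [coeff_sub, hcoeff, if_neg (Nat.pos_iff_ne_zero.mp hd).symm, if_pos rfl, zero_add] at h1
      have h2 : (q : ℤ) ^ 2 ∣ (q : ℤ) := by
        have := dvd_sub h h1
        rwa [sub_sub_cancel] at this
      have hq0 : (0 : ℤ) < q := by exact_mod_cast hq.pos
      have hle := Int.le_of_dvd hq0 h2
      have hq2 : (2 : ℤ) ≤ q := by exact_mod_cast hq.two_le
      nlinarith
  exact hE.irreducible hPprime hf.isPrimitive (by rw [hfd]; exact hd)

/-- A polynomial `f ≡ X^d + q (mod q²)` with `d ≥ 2` has no integer root. [folklore] -/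
theorem eval_ne_zero_of_C_sq_dvd {f : ℤ[X]} {d : ℕ} (hd : 2 ≤ d) {q : ℕ} (hq : q.Prime)
    (hdvd : C ((q : ℤ) ^ 2) ∣ f - (X ^ d + C (q : ℤ))) (m : ℤ) : f.eval m ≠ 0 := by
  intro h0
  have hqZ : Prime (q : ℤ) := Nat.prime_iff_prime_int.mp hq
  have h1 := dvd_eval_sub_of_C_dvd hdvd m
  rw [h0, zero_sub, dvd_neg] at h1
  simp only [eval_add, eval_pow, eval_X, eval_C] at h1
  -- `q² ∣ m^d + q`
  have hq0 : (0 : ℤ) < q := by exact_mod_cast hq.pos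
  have hq2 : (2 : ℤ) ≤ q := by exact_mod_cast hq.two_le
  by_cases hqm : (q : ℤ) ∣ m
  · have h2 : (q : ℤ) ^ 2 ∣ m ^ d := (pow_dvd_pow_of_dvd hqm 2).trans (pow_dvd_pow m hd)
    have h3 : (q : ℤ) ^ 2 ∣ (q : ℤ) := by
      have := dvd_sub h1 h2
      rwa [add_sub_cancel_left] at this
    have hle := Int.le_of_dvd hq0 h3
    nlinarith
  · have h2 : (q : ℤ) ∣ m ^ d + q := (dvd_pow_self (q : ℤ) two_ne_zero).trans h1
    have h3 : (q : ℤ) ∣ m ^ d := by simpa using dvd_sub h2 (dvd_refl (q : ℤ))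
    exact hqm (hqZ.dvd_of_dvd_pow h3)

/-! ### No fixed prime divisor -/

/-- A prime `p` with a witness `p ∤ f(m)` is not a fixed divisor of `f`. [folklore] -/
theorem polyRootCountMod_lt_of_not_dvd {f : ℤ[X]} {p : ℕ} (hp : p.Prime) {m : ℤ}
    (hm : ¬ (p : ℤ) ∣ f.eval m) : polyRootCountMod ![f] p < p := by
  rw [polyRootCountMod_single]
  by_contra hcon
  push Not at hcon
  have hsub : (range p).filter (fun n : ℕ => (p : ℤ) ∣ f.eval (n : ℤ)) = range p :=
    eq_of_subset_of_card_le (filter_subset _ _) (by simpa using hcon)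
  have hp0 : (0 : ℤ) < p := by exact_mod_cast hp.pos
  have h0 : 0 ≤ m % (p : ℤ) := Int.emod_nonneg _ hp0.ne'
  have h1 : m % (p : ℤ) < p := Int.emod_lt_of_pos _ hp0
  set n : ℕ := (m % (p : ℤ)).toNat with hn
  have hn' : (n : ℤ) = m % (p : ℤ) := Int.toNat_of_nonneg h0
  have hnp : n < p := by omega
  have hmem : n ∈ (range p).filter (fun n : ℕ => (p : ℤ) ∣ f.eval (n : ℤ)) := by
    rw [hsub]; exact mem_range.mpr hnp
  have hdn : (p : ℤ) ∣ f.eval (n : ℤ) := (mem_filter.mp hmem).2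
  have hmn : (p : ℤ) ∣ m - n := by rw [hn']; exact Int.dvd_self_sub_emod
  have := dvd_add (hmn.trans (sub_dvd_eval_sub m (n : ℤ) f)) hdn
  rw [sub_add_cancel] at this
  exact hm this

/-- A monic polynomial of degree `< p` does not have the prime `p` as a fixed divisor
(Lagrange). [folklore] -/
theorem polyRootCountMod_lt_of_natDegree_lt {f : ℤ[X]} (hf : f.Monic) {p : ℕ} (hp : p.Prime)
    (hdeg : f.natDegree < p) : polyRootCountMod ![f] p < p := by
  refine lt_of_le_of_lt (polyRootCountMod_single_le_natDegree hp ?_) hdeg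
  rw [hf.leadingCoeff]
  exact_mod_cast hp.not_dvd_one

/-! ### The covering: escaping all primes `p ≤ y` forces `m ≡ ⌊P/2⌋ (mod P)` -/

/-- If `2|m| + 1 < P = ∏_{p ≤ y} p` then some prime `p ≤ y` has `m ≢ ⌊P/2⌋ (mod p)`: otherwise
`P ∣ m − ⌊P/2⌋`, impossible for `|m| < (P − 1)/2`. [folklore] -/
theorem exists_prime_not_dvd_sub (y : ℕ) (m : ℤ) (hm : 2 * |m| + 1 < (primorial y : ℤ)) :
    ∃ p ∈ Nat.primesLE y, ¬ (p : ℤ) ∣ m - ((primorial y / 2 : ℕ) : ℤ) := by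
  by_contra hcon
  push Not at hcon
  set P : ℕ := primorial y with hP
  set r : ℕ := P / 2 with hr
  have hcop : ((Nat.primesLE y : Finset ℕ) : Set ℕ).Pairwise
      (Function.onFun IsCoprime fun p : ℕ => (p : ℤ)) := by
    intro a ha b hb hab
    exact Nat.isCoprime_iff_coprime.mpr ((Nat.coprime_primes (Nat.prime_of_mem_primesLE ha)
      (Nat.prime_of_mem_primesLE hb)).mpr hab)
  have hdvd : (P : ℤ) ∣ m - r := by
    have := Finset.prod_dvd_of_coprime hcop hcon
    rwa [← Nat.cast_prod, ← primorial_eq_prod_primesLE] at this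
  obtain ⟨k, hk⟩ := hdvd
  have hr2 : 2 * (r : ℤ) ≤ P ∧ (P : ℤ) ≤ 2 * r + 1 := by
    constructor <;> [skip; skip] <;> (rw [hr]; omega)
  have habs1 : m ≤ |m| := le_abs_self m
  have habs2 : -m ≤ |m| := neg_le_abs m
  rcases lt_trichotomy k 0 with hk0 | rfl | hk0
  · have hk1 : k ≤ -1 := by omega
    have hP0 : (0 : ℤ) ≤ P := by positivity
    have : (P : ℤ) * k ≤ (P : ℤ) * (-1) := mul_le_mul_of_nonneg_left hk1 hP0
    nlinarith
  · simp only [mul_zero, sub_eq_zero] at hk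
    rw [hk, Nat.abs_cast] at hm
    linarith [hr2.2]
  · have hk1 : 1 ≤ k := by omega
    have hP0 : (0 : ℤ) ≤ P := by positivity
    have : (P : ℤ) * 1 ≤ (P : ℤ) * k := mul_le_mul_of_nonneg_left hk1 hP0
    nlinarith

/-! ### Chebyshev: `2 e^{d/5} + 1 ≤ ∏_{p ≤ ⌊d/2⌋+1} p` for all large `d` -/

/-- The real-variable inequality behind the size comparison: for all large `y`,
`log 3 + 2y/5 ≤ y log 2 − log(y + 1) − 2 √y log y` (because `log y = o(√y)` and
`log 2 > 2/5`). [folklore] -/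
theorem eventually_log_three_add_le :
    ∀ᶠ y : ℝ in atTop, Real.log 3 + 2 * y / 5 ≤
      y * Real.log 2 - Real.log (y + 1) - 2 * Real.sqrt y * Real.log y := by
  have hbound := (isLittleO_log_rpow_atTop (r := 1 / 2) one_half_pos).bound
    (show (0 : ℝ) < 1 / 40 by norm_num)
  filter_upwards [hbound, eventually_ge_atTop (16 : ℝ)] with y hlog hy
  have hy0 : (0 : ℝ) ≤ y := by linarith
  have hsqrt : y ^ (1 / 2 : ℝ) = Real.sqrt y := (Real.sqrt_eq_rpow y).symm
  have hlogy0 : 0 ≤ Real.log y := Real.log_nonneg (by linarith)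
  have hlog' : Real.log y ≤ 1 / 40 * Real.sqrt y := by
    rw [Real.norm_eq_abs, Real.norm_eq_abs, abs_of_nonneg hlogy0, hsqrt,
      abs_of_nonneg (Real.sqrt_nonneg y)] at hlog
    exact hlog
  have hss : Real.sqrt y * Real.sqrt y = y := Real.mul_self_sqrt hy0
  have hs1 : 1 ≤ Real.sqrt y := by
    rw [← Real.sqrt_one]; exact Real.sqrt_le_sqrt (by linarith)
  have hsy : Real.sqrt y ≤ y := by nlinarith
  -- `2 √y log y ≤ y / 20`
  have h1 : 2 * Real.sqrt y * Real.log y ≤ y / 20 := by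
    have := mul_le_mul_of_nonneg_left hlog' (by positivity : (0 : ℝ) ≤ 2 * Real.sqrt y)
    nlinarith
  -- `log (y + 1) ≤ log 2 + log y ≤ 1 + y / 40`
  have h2 : Real.log (y + 1) ≤ Real.log 2 + Real.log y := by
    rw [← Real.log_mul two_ne_zero (by linarith)]
    exact Real.log_le_log (by linarith) (by linarith)
  have h3 : Real.log 2 < 1 := by linarith [Real.log_two_lt_d9]
  have h4 : Real.log 3 ≤ 2 := by linarith [Real.log_le_sub_one_of_pos (show (0 : ℝ) < 3 by norm_num)]
  have h5 : Real.log y ≤ y / 40 := by linarith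
  have h6 : 0.6931471803 < Real.log 2 := Real.log_two_gt_d9
  nlinarith

/-- **Chebyshev input.** For all large `d`, `2 exp(d/5) + 1 ≤ ∏_{p ≤ ⌊d/2⌋+1} p` (Mathlib's
`Chebyshev.theta_ge`: `θ(y) ≥ y log 2 − log(y+1) − 2√y log y`). [folklore] -/
theorem eventually_primorial_ge :
    ∀ᶠ d : ℕ in atTop, 2 * Real.exp ((d : ℝ) / 5) + 1 ≤ (primorial (d / 2 + 1) : ℝ) := by
  -- transfer the real inequality to natural `y`
  have hy : ∀ᶠ y : ℕ in atTop, 3 * Real.exp (2 * (y : ℝ) / 5) ≤ (primorial y : ℝ) := by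
    filter_upwards [tendsto_natCast_atTop_atTop.eventually eventually_log_three_add_le]
      with y hy
    have htheta := Chebyshev.theta_ge y
    rw [Chebyshev.theta_eq_log_primorial, Nat.floor_natCast] at htheta
    have hpos : (0 : ℝ) < primorial y := by exact_mod_cast primorial_pos y
    have hle : Real.log 3 + 2 * (y : ℝ) / 5 ≤ Real.log (primorial y) := hy.trans htheta
    have := Real.exp_le_exp.mpr hle
    rwa [Real.exp_add, Real.exp_log (by norm_num : (0 : ℝ) < 3), Real.exp_log hpos] at this
  -- and from `y = ⌊d/2⌋ + 1` back to `d`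
  have htend : Tendsto (fun d : ℕ => d / 2 + 1) atTop atTop := by
    refine tendsto_atTop_atTop.mpr fun b => ⟨2 * b, fun n hn => ?_⟩
    omega
  filter_upwards [htend.eventually hy] with d hd
  have h2y : (d : ℝ) ≤ 2 * ((d / 2 + 1 : ℕ) : ℝ) := by
    have : d ≤ 2 * (d / 2 + 1) := by omega
    exact_mod_cast this
  have hexp : Real.exp ((d : ℝ) / 5) ≤ Real.exp (2 * ((d / 2 + 1 : ℕ) : ℝ) / 5) :=
    Real.exp_le_exp.mpr (by linarith)
  have hone : 1 ≤ Real.exp ((d : ℝ) / 5) := Real.one_le_exp (by positivity)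
  linarith

/-! ### The length of a polynomial with bounded non-negative coefficients -/

/-- If `f` is monic of degree `d` with coefficients in `[0, 2^B)` (`B ≥ 1`) then
`L(f) ≤ d B + 1`. [folklore] -/
theorem polyLength_le_of_coeff_lt {f : ℤ[X]} {d B : ℕ} (hB : 1 ≤ B) (hf : f.Monic)
    (hfd : f.natDegree = d) (h0 : ∀ k, 0 ≤ f.coeff k)
    (hlt : ∀ k, k < d → f.coeff k < (2 : ℤ) ^ B) : polyLength f ≤ d * B + 1 := by
  unfold polyLength
  rw [hfd, sum_range_succ]
  have htop : binaryLength (f.coeff d).natAbs = 1 := by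
    have : f.coeff d = 1 := by rw [← hfd]; exact hf.coeff_natDegree
    rw [this]; exact binaryLength_one
  rw [htop]
  gcongr
  calc ∑ k ∈ range d, binaryLength (f.coeff k).natAbs ≤ ∑ _k ∈ range d, B := by
        refine sum_le_sum fun k hk => ?_
        rw [mem_range] at hk
        unfold binaryLength
        refine max_le hB (Nat.size_le.mpr ?_)
        have h1 : ((f.coeff k).natAbs : ℤ) = f.coeff k := Int.natAbs_of_nonneg (h0 k)
        have h2 : ((f.coeff k).natAbs : ℤ) < (2 : ℤ) ^ B := h1 ▸ hlt k hk
        exact_mod_cast h2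
    _ = d * B := by rw [sum_const, card_range, smul_eq_mul]

/-! ### The construction in large degree -/

/-- **Main construction.** For `d ≥ 2` with `2 e^{d/5} + 1 ≤ ∏_{p ≤ ⌊d/2⌋+1} p` there is an
irreducible `f` of degree `d` (monic, Eisenstein at a Bertrand prime `q ∈ (d, 2d]`) without fixed
prime divisor whose values at all integers `|m| < exp((1/25) √(L(f)/log L(f)))` are composite.
[folklore] -/
theorem exists_poly_of_primorial_ge {d : ℕ} (hd : 2 ≤ d)
    (hP : 2 * Real.exp ((d : ℝ) / 5) + 1 ≤ (primorial (d / 2 + 1) : ℝ)) :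
    ∃ f : ℤ[X], f.natDegree = d ∧ Irreducible f ∧ HasNoFixedPrimeDivisor ![f] ∧
      ∀ m : ℤ, (|m| : ℝ) <
          Real.exp (1 / 25 * Real.sqrt (polyLength f / Real.log (polyLength f))) →
        IsComposite (f.eval m).natAbs := by
  classical
  -- parameters
  set y : ℕ := d / 2 + 1 with hy
  have hyd : y ≤ d := by omega
  set r : ℤ := ((primorial y / 2 : ℕ) : ℤ) with hr
  obtain ⟨q, hq, hdq, hq2d⟩ := Nat.exists_prime_lt_and_le_two_mul d (by omega)
  have hqy : ¬ q ≤ y := by omega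
  have hq_notmem : q ∉ Nat.primesLE d := fun h => absurd (Nat.le_of_mem_primesLE h) (by omega)
  -- CRT data
  let U : Finset ℕ := insert q (Nat.primesLE d)
  let μ : ℕ → ℕ := fun p => p ^ 2
  let t : ℕ → ℤ[X] := fun p =>
    if p ≤ y then (X - C (r - 1)) ^ (d - 2 * (p - 1)) * ((X - C r) ^ (p - 1) - 1) ^ 2
    else if p = q then X ^ d + C (q : ℤ) else X ^ d
  have hUprime : ∀ p ∈ U, p.Prime := by
    intro p hp
    rcases Finset.mem_insert.mp hp with rfl | hp
    · exact hq
    · exact Nat.prime_of_mem_primesLE hp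
  have hμ : ∀ p ∈ U, μ p ≠ 0 := fun p hp => pow_ne_zero 2 (hUprime p hp).ne_zero
  have hcop : (U : Set ℕ).Pairwise (Function.onFun Nat.Coprime μ) := by
    intro a ha b hb hab
    exact ((Nat.coprime_primes (hUprime a ha) (hUprime b hb)).mpr hab).pow 2 2
  have ht_small : ∀ p, p ≤ y →
      t p = (X - C (r - 1)) ^ (d - 2 * (p - 1)) * ((X - C r) ^ (p - 1) - 1) ^ 2 := by
    intro p hp; simp [t, hp]
  have ht_q : t q = X ^ d + C (q : ℤ) := by simp [t, hqy]
  have ht_mid : ∀ p, ¬ p ≤ y → p ≠ q → t p = X ^ d := by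
    intro p hp hpq; simp [t, hp, hpq]
  have ht : ∀ p ∈ U, (t p).Monic ∧ (t p).natDegree = d := by
    intro p hp
    have hpp := hUprime p hp
    by_cases hpy : p ≤ y
    · rw [ht_small p hpy]
      obtain ⟨hm, hdeg⟩ := monic_localPoly hpp.two_le r (d - 2 * (p - 1))
      refine ⟨hm, ?_⟩
      rw [hdeg]; omega
    · by_cases hpq : p = q
      · rw [hpq, ht_q]
        exact ⟨monic_X_pow_add_C _ (by omega), natDegree_X_pow_add_C⟩
      · rw [ht_mid p hpy hpq]
        exact ⟨monic_X_pow d, natDegree_X_pow d⟩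
  obtain ⟨f, hfm, hfd, h0, hlt, hdv⟩ := exists_monic_crt U μ t d hμ hcop ht
  -- the three kinds of congruences
  have hdv_small : ∀ p ∈ Nat.primesLE y,
      C ((p : ℤ) ^ 2) ∣ f - (X - C (r - 1)) ^ (d - 2 * (p - 1)) * ((X - C r) ^ (p - 1) - 1) ^ 2 := by
    intro p hp
    have hpy : p ≤ y := Nat.le_of_mem_primesLE hp
    have hpU : p ∈ U := Finset.mem_insert_of_mem
      (Nat.mem_primesLE.mpr ⟨hpy.trans hyd, Nat.prime_of_mem_primesLE hp⟩)
    have := hdv p hpU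
    rw [ht_small p hpy] at this
    simpa [μ] using this
  have hdv_q : C ((q : ℤ) ^ 2) ∣ f - (X ^ d + C (q : ℤ)) := by
    have := hdv q (Finset.mem_insert_self q _)
    rw [ht_q] at this
    simpa [μ] using this
  have hdv_mid : ∀ p ∈ Nat.primesLE d, ¬ p ≤ y → C ((p : ℤ) ^ 2) ∣ f - X ^ d := by
    intro p hp hpy
    have hpq : p ≠ q := fun h => hq_notmem (h ▸ hp)
    have := hdv p (Finset.mem_insert_of_mem hp)
    rw [ht_mid p hpy hpq] at this
    simpa [μ] using this
  -- irreducible, no integer roots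
  have hirr : Irreducible f := irreducible_of_C_sq_dvd (by omega) hfm hfd hq hdv_q
  have hne : ∀ m : ℤ, f.eval m ≠ 0 := eval_ne_zero_of_C_sq_dvd hd hq hdv_q
  -- no fixed prime divisor
  have hfix : HasNoFixedPrimeDivisor ![f] := by
    intro p hp
    by_cases hpy : p ≤ y
    · -- witness `r`: `f(r) ≡ h_p(r) = 1 (mod p²)`
      refine polyRootCountMod_lt_of_not_dvd hp (m := r) fun hpr => ?_
      have h1 := dvd_eval_sub_of_C_dvd (hdv_small p (Nat.mem_primesLE.mpr ⟨hpy, hp⟩)) r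
      rw [eval_localPoly_self hp.two_le] at h1
      have h2 : (p : ℤ) ∣ f.eval r - 1 := (dvd_pow_self (p : ℤ) two_ne_zero).trans h1
      have h3 : (p : ℤ) ∣ 1 := by simpa using dvd_sub hpr h2
      exact hp.not_dvd_one (by exact_mod_cast h3)
    by_cases hpd : p ≤ d
    · -- witness `1`: `f(1) ≡ 1 (mod p²)`
      refine polyRootCountMod_lt_of_not_dvd hp (m := 1) fun hp1 => ?_
      have h1 := dvd_eval_sub_of_C_dvd (hdv_mid p (Nat.mem_primesLE.mpr ⟨hpd, hp⟩) hpy) 1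
      simp only [eval_pow, eval_X, one_pow] at h1
      have h2 : (p : ℤ) ∣ f.eval 1 - 1 := (dvd_pow_self (p : ℤ) two_ne_zero).trans h1
      have h3 : (p : ℤ) ∣ 1 := by simpa using dvd_sub hp1 h2
      exact hp.not_dvd_one (by exact_mod_cast h3)
    by_cases hpq : p = q
    · -- witness `1`: `f(1) ≡ 1 + q (mod q²)`
      subst hpq
      refine polyRootCountMod_lt_of_not_dvd hp (m := 1) fun hp1 => ?_
      have h1 := dvd_eval_sub_of_C_dvd hdv_q 1
      simp only [eval_add, eval_pow, eval_X, one_pow, eval_C] at h1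
      have h2 : (p : ℤ) ∣ f.eval 1 - (1 + p) := (dvd_pow_self (p : ℤ) two_ne_zero).trans h1
      have h3 : (p : ℤ) ∣ 1 + p := by simpa using dvd_sub hp1 h2
      have h4 : (p : ℤ) ∣ 1 := by simpa using dvd_sub h3 (dvd_refl (p : ℤ))
      exact hp.not_dvd_one (by exact_mod_cast h4)
    · -- `p > d`, `p ≠ q`: Lagrange
      exact polyRootCountMod_lt_of_natDegree_lt hfm hp (by omega)
  -- the size of the coefficients and the length
  have hQ : (∏ p ∈ U, (μ p : ℤ)) ≤ (2 : ℤ) ^ (6 * d + 2) := by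
    have h1 : ∏ p ∈ U, μ p = q ^ 2 * (primorial d) ^ 2 := by
      simp only [U, μ]
      rw [Finset.prod_insert hq_notmem, primorial_eq_prod_primesLE, Finset.prod_pow]
    have hq' : q ≤ 2 ^ (d + 1) := by
      have := Nat.lt_two_pow_self (n := d)
      rw [pow_succ]; omega
    have hprim : primorial d ≤ 2 ^ (2 * d) := by
      rw [pow_mul]; exact primorial_le_four_pow d
    have h2 : q ^ 2 * (primorial d) ^ 2 ≤ 2 ^ (6 * d + 2) :=
      calc q ^ 2 * (primorial d) ^ 2 ≤ (2 ^ (d + 1)) ^ 2 * (2 ^ (2 * d)) ^ 2 := by gcongr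
        _ = 2 ^ (6 * d + 2) := by ring
    have h3 : ((∏ p ∈ U, μ p : ℕ) : ℤ) ≤ ((2 ^ (6 * d + 2) : ℕ) : ℤ) := by
      rw [h1]; exact_mod_cast h2
    simpa using h3
  have hlen : polyLength f ≤ d * (6 * d + 2) + 1 :=
    polyLength_le_of_coeff_lt (B := 6 * d + 2) (by omega) hfm hfd h0
      (fun k hk => (hlt k hk).trans_le hQ)
  have hL2 : 2 ≤ polyLength f := by have := natDegree_lt_polyLength f; omega
  have hLle : (polyLength f : ℝ) ≤ d * (6 * d + 2) + 1 := by exact_mod_cast hlen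
  have hd1 : (1 : ℝ) ≤ d := by exact_mod_cast (show 1 ≤ d by omega)
  have hlog : (1 : ℝ) / 2 ≤ Real.log (polyLength f) := by
    have h2 : Real.log 2 ≤ Real.log (polyLength f) :=
      Real.log_le_log two_pos (by exact_mod_cast hL2)
    linarith [Real.log_two_gt_d9]
  have hL0 : (0 : ℝ) ≤ polyLength f := by positivity
  have hdiv : (polyLength f : ℝ) / Real.log (polyLength f) ≤ 2 * polyLength f := by
    rw [div_le_iff₀ (by linarith)]; nlinarith
  have hsqrt : Real.sqrt (polyLength f / Real.log (polyLength f)) ≤ 5 * d := by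
    refine Real.sqrt_le_iff.mpr ⟨by positivity, ?_⟩
    nlinarith
  -- composite values
  refine ⟨f, hfd, hirr, hfix, fun m hm => ?_⟩
  have hm' : (|m| : ℝ) < Real.exp ((d : ℝ) / 5) := by
    refine lt_of_lt_of_le hm (Real.exp_le_exp.mpr ?_)
    calc 1 / 25 * Real.sqrt (polyLength f / Real.log (polyLength f)) ≤ 1 / 25 * (5 * d) := by
          gcongr
      _ = d / 5 := by ring
  have h2m : 2 * |m| + 1 < (primorial y : ℤ) := by
    have : (2 * |(m : ℝ)| + 1 : ℝ) < (primorial y : ℝ) := by linarith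
    exact_mod_cast this
  obtain ⟨p, hp, hndvd⟩ := exists_prime_not_dvd_sub y m h2m
  have hpp := Nat.prime_of_mem_primesLE hp
  have h1 := dvd_eval_sub_of_C_dvd (hdv_small p hp) m
  have h2 := sq_dvd_eval_localPoly hpp r (d - 2 * (p - 1)) hndvd
  have h3 : (p : ℤ) ^ 2 ∣ f.eval m := by simpa using dvd_add h1 h2
  exact isComposite_natAbs_of_sq_dvd hpp (hne m) h3

/-! ### Small degrees: `X^d + 26` -/

/-- `‖26‖ = 5` (`26 = 11010₂`). [folklore] -/
theorem binaryLength_26 : binaryLength 26 = 5 := by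
  rw [binaryLength_of_pos (by norm_num)]
  apply le_antisymm
  · exact Nat.size_le.mpr (by norm_num)
  · exact Nat.lt_size.mpr (by norm_num)

/-- `X^d + 26` (`d ≥ 1`) is irreducible (Eisenstein at `2`, `26 = 2 · 13`), has no fixed prime
divisor, has length `L = d + 5`, and takes the composite values `25, 26, 27` at `m ∈ {−1, 0, 1}`.
[folklore] -/
theorem X_pow_add_26 {d : ℕ} (hd : 1 ≤ d) :
    (X ^ d + C (26 : ℤ) : ℤ[X]).natDegree = d ∧ Irreducible (X ^ d + C (26 : ℤ) : ℤ[X]) ∧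
      HasNoFixedPrimeDivisor ![(X ^ d + C (26 : ℤ) : ℤ[X])] ∧
      polyLength (X ^ d + C (26 : ℤ) : ℤ[X]) = d + 5 ∧
      ∀ m : ℤ, |m| < 2 → IsComposite ((X ^ d + C (26 : ℤ) : ℤ[X]).eval m).natAbs := by
  have hd0 : d ≠ 0 := by omega
  refine ⟨natDegree_X_pow_add_C, ?_, ?_, ?_, ?_⟩
  · refine irreducible_of_C_sq_dvd (q := 2) (Nat.pos_of_ne_zero hd0) (monic_X_pow_add_C _ hd0)
      natDegree_X_pow_add_C Nat.prime_two ⟨C 6, ?_⟩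
    rw [add_sub_add_left_eq_sub, ← C_sub, ← C_mul]
    norm_num
  · exact hasNoFixedPrimeDivisor_X_pow_add_C (Nat.pos_of_ne_zero hd0) (26 : ℤ)
  · rw [polyLength_X_pow_add_C hd]
    simp [binaryLength_26]
  · intro m hm
    have hm' : m = -1 ∨ m = 0 ∨ m = 1 := by
      rcases abs_lt.mp hm with ⟨h1, h2⟩; omega
    simp only [eval_add, eval_pow, eval_X, eval_C]
    rcases hm' with rfl | rfl | rfl
    · rcases neg_one_pow_eq_or ℤ d with h | h <;> rw [h]
      · exact ⟨by norm_num, by norm_num⟩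
      · exact ⟨by norm_num, by norm_num⟩
    · rw [zero_pow hd0, zero_add]; exact ⟨by norm_num, by norm_num⟩
    · rw [one_pow]; exact ⟨by norm_num, by norm_num⟩

end NoSmallPrimeValues

/-! ### The discharge -/

open NoSmallPrimeValues in
/-- **McCurley, *Polynomials with no small prime values* (Proc. AMS 1986), as reported by
Ribenboim — PROVED.** There is an absolute `c > 0` such that for every `d ≥ 1` some irreducible
`f ∈ ℤ[X]` of degree `d` with no fixed prime divisor (`D(f) = 1`) has `|f(m)|` composite for all
integers `m` with `|m| < e^{c √(L(f)/log L(f))}`. Discharges the named fact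
`McCurley1986_noSmallPrimeValues`; the proof is the elementary Chinese-remainder construction of
this file (large `d`, `exists_poly_of_primorial_ge`, with Chebyshev's `θ(y) ≥ y log 2 − o(y)`),
together with `X^d + 26` in small degree, and `c = min(1/25, log 2/(2(D₀ + 4)))`; it is not
McCurley's own argument (primary source not held).
[cite: Ribenboim1989, Ch. 6 §III.B p. 330] [cite: McCurley1986NoSmallPrimeValues, Theorem (as reported)] -/
theorem McCurley1986_noSmallPrimeValues_holds : McCurley1986_noSmallPrimeValues := by
  obtain ⟨D, hD⟩ := eventually_atTop.mp eventually_primorial_ge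
  set D' : ℕ := max D 2 with hD'
  have hDpos : (0 : ℝ) < 2 * ((D' : ℝ) + 4) := by positivity
  refine ⟨min (1 / 25) (Real.log 2 / (2 * ((D' : ℝ) + 4))),
    lt_min (by norm_num) (div_pos (Real.log_pos one_lt_two) hDpos), fun d hd => ?_⟩
  by_cases hdD : d < D'
  · -- small degree: `X^d + 26`, range `< 2`
    obtain ⟨hdeg, hirr, hfix, hlen, hcomp⟩ := X_pow_add_26 hd
    refine ⟨_, hdeg, hirr, hfix, fun m hm => hcomp m ?_⟩
    set L : ℕ := polyLength (X ^ d + C (26 : ℤ) : ℤ[X]) with hL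
    have hd0 : (0 : ℝ) ≤ d := by positivity
    have hL2 : (2 : ℝ) ≤ L := by rw [hlen]; push_cast; linarith
    have hLD : (L : ℝ) ≤ D' + 4 := by
      rw [hlen]; push_cast
      have : (d : ℝ) + 1 ≤ D' := by exact_mod_cast hdD
      linarith
    have hlog : (1 : ℝ) / 2 ≤ Real.log L := by
      have := Real.log_le_log two_pos hL2
      linarith [Real.log_two_gt_d9]
    have hdiv : (L : ℝ) / Real.log L ≤ 2 * L := by
      rw [div_le_iff₀ (by linarith)]; nlinarith
    have hsqrt : Real.sqrt (L / Real.log L) ≤ 2 * L := by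
      refine Real.sqrt_le_iff.mpr ⟨by positivity, ?_⟩
      nlinarith
    have hexp : Real.exp (min (1 / 25) (Real.log 2 / (2 * ((D' : ℝ) + 4))) *
        Real.sqrt (L / Real.log L)) ≤ 2 := by
      have h1 : min (1 / 25) (Real.log 2 / (2 * ((D' : ℝ) + 4))) * Real.sqrt (L / Real.log L)
          ≤ Real.log 2 / (2 * ((D' : ℝ) + 4)) * (2 * ((D' : ℝ) + 4)) :=
        mul_le_mul (min_le_right _ _) (hsqrt.trans (by linarith)) (Real.sqrt_nonneg _)
          (div_nonneg (Real.log_nonneg one_le_two) hDpos.le)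
      rw [div_mul_cancel₀ _ hDpos.ne'] at h1
      calc _ ≤ Real.exp (Real.log 2) := Real.exp_le_exp.mpr h1
        _ = 2 := Real.exp_log two_pos
    have : (|m| : ℝ) < 2 := lt_of_lt_of_le hm hexp
    exact_mod_cast this
  · -- large degree
    push Not at hdD
    have hd2 : 2 ≤ d := le_trans (le_max_right _ _) hdD
    have hdD1 : D ≤ d := le_trans (le_max_left _ _) hdD
    obtain ⟨f, hfd, hirr, hfix, hcomp⟩ := exists_poly_of_primorial_ge hd2 (hD d hdD1)
    refine ⟨f, hfd, hirr, hfix, fun m hm => hcomp m (lt_of_lt_of_le hm ?_)⟩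
    exact Real.exp_le_exp.mpr
      (mul_le_mul_of_nonneg_right (min_le_left _ _) (Real.sqrt_nonneg _))

end Literature.Barriers.Parity
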